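import Literature.AlgebraicGeometry.Resolution.ArithmeticalThreefoldsReduction
import Literature.AlgebraicGeometry.Resolution.KrullRamificationGroups
import HarnessLib

/-!
# Cossart–Piltant, Prop. 4.10 in residue characteristic zero: reduction of (LU) to the climb

Topic: `Literature/AlgebraicGeometry/Resolution`. PROOF side of the named fact
`CossartPiltant2019LUCompleteChar0` (`ArithmeticalThreefoldsLocal.lean`): (LU) for complete
Noetherian local domains of dimension three whose residue field has characteristic `0`.
Cossart–Piltant 2019, proof of journal Prop. 4.10 = arXiv v1 Prop. 4.8 (p. 53), dismiss this case
in one clause — "We may assume here that `char k_v = p > 0`, the equicharacteristic zero version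
of theorem 1.1 being known" (Hironaka 1964) — and the tree discharges it that way modulo the
single leaf `Hironaka1964_local` (`LUCompleteChar0TrustBase.lean`,
`CossartPiltant2019LUCompleteChar0.of_hironaka1964_local`).

This file opens the SECOND road, the one the source itself takes in residue characteristic
`p > 0` (v1 p. 54): Cohen's structure theorem `S ⊆ A` ([Ma] Thm. 29.4 (iii)), `F = QF(S)`,
`K | F` finite, and the climb `(LU v₀) ⇒ (LU v₀ⁱ) ⇒ (LU v₀ʳ) ⇒ (LU vʳ) ⇒ (LU vⁱ) ⇒ (LU v)` along
the ramification-theoretic tower of a Galois closure. Nothing in that frame requires `p > 0`: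
Cohen's structure theorem (`Matsumura1987_29_4_iii_holds`) and the excellence of complete local
rings (`isExcellentRing_of_isAdicComplete`) are characteristic free, and so is the reduction of
(LU) for `A` to a climbing statement over the Cohen subring proved in
`ArithmeticalThreefoldsReduction.lean` (`cossartPiltant2019ReductionP_of_climb`) — except that
it is stated there behind `CossartPiltant2019Local →` and `p.Prime`. Here:

* `cpLocalUniformization_of_climbAt` — PROVED, the same reduction POINTWISE in the residue
  characteristic `p : ℕ` (any natural number, `0` included) and in `A`, with no local theorem in
  the hypothesis: if the climbing statement holds over every complete excellent regular local
  domain `S` of dimension three with `char (S/𝔪_S) = p`, then (LU) holds for every complete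
  Noetherian local domain `A` of dimension three with `char (A/𝔪_A) = p`. The proof is that of
  `cossartPiltant2019ReductionP_of_climb`, verbatim up to the two hypotheses it never used.
* `CossartPiltant2019LUCompleteChar0.of_climb` — PROVED: the case `p = 0`, i.e.
  `CossartPiltant2019LUCompleteChar0` follows from the climbing statement over complete excellent
  regular local domains `S` of dimension three with `CharZero (S/𝔪_S)`.
* (For `p` prime, `cpLocalUniformization_of_climbAt p` applied behind `CossartPiltant2019Local →`
  is `cossartPiltant2019ReductionP_of_climb` again; not restated.)
* Residue characteristic zero along the climb — PROVED bookkeeping for the frame: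
  `charZero_of_charZero_residueField` (a local ring with residue field of characteristic `0` has
  characteristic `0`), `charZero_residueField_valuationSubring_of_forall_mem` (a valuation ring
  `O_E ⊇ S` has residue characteristic `0` when `S` has), and
  `fixedField_ramificationGroupIn_eq_top_of_charZero` — **in residue characteristic `0` the
  ramification field of a finite Galois extension is the whole extension** (`G_V = 1`,
  `ramificationGroupIn_eq_bot_of_charZero`, Zariski–Samuel VI §12 Thm. 24): the step
  `(LU v₀ʳ) ⇒ (LU vʳ)` of the chain — the only place where Thm. 1.5 (ii) enters — is EMPTY, and so
  is the purely inseparable preamble `K ⊇ K^{sep}` ("trivial (`char K = 0`)", v1 p. 54), the only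
  place where Thm. 1.5 (i) enters.

Consequently, in residue characteristic `0` the climbing statement consists exactly of the
characteristic-free frame of the source's proof: the unramified ascent `F → Fⁱ` ([CoP1] Cor. 7.3
with Galois approximation, journal Prop. 4.13; `ArithmeticalThreefoldsLocalEtaleClimb.lean`), the
tame ascent `Fⁱ → Fʳ` ([CoP1] Props. 6.2, 6.3, Perron), the descents `K̄ = Fʳ → K·Fⁱ → K`
([CoP1] Props. 9.1, 9.3), cofinality of local uniformizations (principalization, journal
Prop. 4.4 = `CossartPiltant2019Principalization`) and the reduction to rank one ([NSp]) — the
same frame the residue-characteristic-`p` reduction `CossartPiltant2019ReductionP` rests on.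
When that frame is formal, `CossartPiltant2019LUCompleteChar0` no longer needs Hironaka's
theorem.

Everything here is PROVED; no named facts are introduced.

## Sources

* V. Cossart, O. Piltant, J. Algebra 529 (2019) 268–535 = arXiv:1412.0868, proof of Prop. 4.10
  (arXiv v1: Prop. 4.8, pp. 53–54). [CossartPiltant2019]
* H. Matsumura, *Commutative Ring Theory*, CUP 1986, Thm. 29.4 (iii). [Matsumura1987]
* O. Zariski, P. Samuel, *Commutative Algebra* II (1960), Ch. VI §12, Thm. 24. [ZariskiSamuel1960]
-/

noncomputable section

open IsLocalRing Polynomial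

namespace Literature.AlgebraicGeometry.Resolution

universe u

/-! ## Residue characteristic zero: bookkeeping -/

section CharZeroBookkeeping

/-- A local ring whose residue field has characteristic `0` has characteristic `0` (a nonzero
natural number is a unit). [folklore] -/
theorem charZero_of_charZero_residueField (S : Type*) [CommRing S] [IsLocalRing S]
    [CharZero (ResidueField S)] : CharZero S := by
  refine charZero_of_inj_zero fun n hn => ?_
  have h : (n : ResidueField S) = 0 := by
    rw [← map_natCast (residue S) n, hn, map_zero]
  exact Nat.cast_eq_zero.mp h

/-- **A valuation ring containing a local ring of residue characteristic `0` has residue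
characteristic `0`**: for `S` local with `char (S/𝔪_S) = 0` and `O_E` a valuation ring of a
field `E ⊇ S` with `S ⊆ O_E`, `char (O_E/𝔪_{O_E}) = 0` (a nonzero `n ∈ ℕ` is a unit of `S`,
hence of `O_E`). In Cossart–Piltant's climb this is "`char k_v = char k`" (`k ⊆ k_v`).
[cite: CossartPiltant2019, proof of Prop. 4.10 (arXiv v1: Prop. 4.8, p. 53)] -/
theorem charZero_residueField_valuationSubring_of_forall_mem {S E : Type*} [CommRing S]
    [IsLocalRing S] [Field E] [Algebra S E] [CharZero (ResidueField S)]
    (OE : ValuationSubring E) (hSO : ∀ s : S, algebraMap S E s ∈ OE) :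
    CharZero (ResidueField OE) := by
  refine charZero_of_inj_zero fun n hn => ?_
  by_contra h0
  -- `n` is a unit of `S`
  have hunitS : IsUnit (n : S) := by
    rw [← residue_ne_zero_iff_isUnit, map_natCast]
    exact_mod_cast h0
  -- hence of `O_E`
  let φ : S →+* OE := (algebraMap S E).codRestrict OE.toSubring fun s => hSO s
  have hunitO : IsUnit (n : OE) := by
    have := hunitS.map φ
    rwa [map_natCast] at this
  refine (residue_ne_zero_iff_isUnit _).mpr hunitO ?_
  rw [map_natCast]
  exact hn

/-- The fraction-field side: a field containing (injectively) a local ring of residue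
characteristic `0` has characteristic `0`. [folklore] -/
theorem charZero_of_injective_of_charZero_residueField {S E : Type*} [CommRing S]
    [IsLocalRing S] [Field E] [Algebra S E] [CharZero (ResidueField S)]
    (hinj : Function.Injective (algebraMap S E)) : CharZero E := by
  haveI : CharZero S := charZero_of_charZero_residueField S
  exact charZero_of_injective_ringHom hinj

end CharZeroBookkeeping

section RamificationField

open _root_.IntermediateField

variable {Ω : Type u} [Field Ω] (V : ValuationSubring Ω) {M : Subfield Ω}
  (N : IntermediateField M Ω)

/-- **In residue characteristic `0` the ramification field is everything.** For a finite
extension `N | M` inside the valued field `(Ω, V)` with `char (V/𝔐_V) = 0`, the large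
ramification group `G_V` is trivial (Zariski–Samuel VI §12, Thm. 24:
`ramificationGroupIn_eq_bot_of_charZero`), so its fixed field — the ramification field `Fʳ` of
Cossart–Piltant's diagram (51) — is all of `N`. Hence `Kʳ = K·Fʳ = K̄` and the step
`(LU v₀ʳ) ⇒ (LU vʳ)` of the proof of Prop. 4.10, the only consumer of Thm. 1.5 (ii), is empty
in residue characteristic `0`. [cite: ZariskiSamuel1960, Ch. VI §12, Thm. 24]
[cite: CossartPiltant2019, proof of Prop. 4.10 (arXiv v1: Prop. 4.8, p. 54)] -/
theorem fixedField_ramificationGroupIn_eq_top_of_charZero [CharZero (ResidueField V)]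
    [FiniteDimensional M N] :
    fixedField (ramificationGroupIn V N) = ⊤ := by
  rw [ramificationGroupIn_eq_bot_of_charZero V N]
  exact fixedField_bot

/-- The same, membership form: every element of `N` lies in the ramification field.
[cite: ZariskiSamuel1960, Ch. VI §12, Thm. 24] -/
theorem mem_fixedField_ramificationGroupIn_of_charZero [CharZero (ResidueField V)]
    [FiniteDimensional M N] (x : N) : x ∈ fixedField (ramificationGroupIn V N) := by
  rw [fixedField_ramificationGroupIn_eq_top_of_charZero V N]
  exact mem_top

end RamificationField

/-! ## The reduction to the climb, pointwise in the residue characteristic -/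

/-- **Cossart–Piltant 2019, proof of Prop. 4.10 (arXiv v1 Prop. 4.8), the reduction steps
preceding the ramification-theoretic climb — pointwise in the residue characteristic.** Let
`p : ℕ` (a prime or `0`). Suppose that for every complete excellent regular local domain `S` of
dimension three with `char (S/𝔪_S) = p`, every valuation ring `O_E` of an algebraically closed
field `E ⊇ S` (algebraic over `S`) containing and dominating `S` with residue field algebraic
over `S/𝔪_S`, and every finitely generated subfield `K = Frac(S)(s₀) ⊆ E`, SOME finitely
generated model `S[t] ⊆ O_E` with `t ⊆ K` and `Frac S[t] = K` is regular at the centre of `O_E`.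
Then (LU) (`CPLocalUniformization`) holds for every complete Noetherian local domain `A` of
dimension three with `char (A/𝔪_A) = p`. The proof is that of
`cossartPiltant2019ReductionP_of_climb`: one fraction field `K₀` of `A`
(`cpLocalUniformization_of_fractionField'`); Cohen subring `S ⊆ A` (`exists_cohen_subring`,
[Ma] Thm. 29.4 (iii) — characteristic free); `E = K̄₀` and an extension `O_E` of `𝒪_v`
(Chevalley); domination and residue algebraicity moved from `(A, K₀, 𝒪_v)` to `(S, E, O_E)`;
the climbing hypothesis applied to `K = K₀ ⊆ E`, generated over `F` by `S`-module generators
of `A`; the model pulled back to `K₀` with `Frac S[t] = K₀`; and `S[t] ⊆ A[t] ⊆ S[t]_P` by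
normality of the regular local ring `S[t]_P`.
[cite: CossartPiltant2019, proof of Prop. 4.10 (arXiv v1: Prop. 4.8, pp. 53–54)]
[cite: Matsumura1987, Thm. 29.4 (iii)] -/
theorem cpLocalUniformization_of_climbAt (p : ℕ)
    (H : ∀ (S : Type u) [CommRing S] [IsDomain S] [IsRegularLocalRing S],
        IsExcellentRing S → ringKrullDim S = 3 → CharP (ResidueField S) p →
        IsAdicComplete (maximalIdeal S) S →
      ∀ (E : Type u) [Field E] [Algebra S E], Function.Injective (algebraMap S E) →
        IsAlgClosed E → Algebra.IsAlgebraic S E →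
      ∀ (OE : ValuationSubring E), (∀ s : S, algebraMap S E s ∈ OE) →
        (∀ s ∈ maximalIdeal S, OE.valuation (algebraMap S E s) < 1) →
        (∀ y : OE, ∃ q : S[X], (∃ i, q.coeff i ∉ maximalIdeal S) ∧
          OE.valuation (q.eval₂ (algebraMap S E) y) < 1) →
      ∀ (s₀ : Finset E),
        ∃ t : Finset E,
          (t : Set E) ⊆ Subfield.closure (Set.range (algebraMap S E) ∪ (s₀ : Set E)) ∧
          (s₀ : Set E) ⊆ Subfield.closure (Set.range (algebraMap S E) ∪ (t : Set E)) ∧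
          ∃ hTO : (Algebra.adjoin S (t : Set E)).toSubring ≤ OE.toSubring,
            IsRegularLocalRing (Localization.AtPrime
              (Ideal.comap (Subring.inclusion hTO) (maximalIdeal OE))))
    (A : Type u) [CommRing A] [IsDomain A] [IsLocalRing A] [IsNoetherianRing A]
    [IsAdicComplete (maximalIdeal A) A] (hdim : ringKrullDim A = 3)
    (hchar : CharP (ResidueField A) p) :
    CPLocalUniformization A := by
  classical
  refine cpLocalUniformization_of_fractionField' A (FractionRing A) fun O hAO hdom halg => ?_
  -- Cohen subring `S ⊆ A`
  obtain ⟨S, hreg, hcomp, hfin, hexc, hdimS, hcharS⟩ := exists_cohen_subring p A hdim hchar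
  haveI := hreg
  haveI := hcomp
  haveI := hfin
  haveI : Algebra.IsIntegral S A := Algebra.IsIntegral.of_finite S A
  haveI : IsLocalHom (algebraMap S A) := isLocalHom_algebraMap_of_isIntegral
  -- the fields `K₀ = Frac A ⊆ E = K̄₀` and an extension `O_E` of `O`
  set K₀ := FractionRing A with hK₀
  let E := AlgebraicClosure K₀
  obtain ⟨OE, hOE⟩ := exists_valuationSubring_comap_eq (Ω := E) O
  let φ : K₀ →ₐ[S] E := IsScalarTower.toAlgHom S K₀ E
  have hφ : ∀ z, φ z = algebraMap K₀ E z := fun _ => rfl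
  have hSE : ∀ s : S, algebraMap S E s = algebraMap K₀ E (algebraMap A K₀ (s : A)) := fun s => by
    rw [IsScalarTower.algebraMap_apply S K₀ E, IsScalarTower.algebraMap_apply S A K₀]
    rfl
  -- hypotheses of the climb at the level of `S`
  have hinjSE : Function.Injective (algebraMap S E) := by
    intro a b hab
    rw [hSE, hSE] at hab
    exact Subtype.val_injective (IsFractionRing.injective A K₀ ((algebraMap K₀ E).injective hab))
  have halgSE : Algebra.IsAlgebraic S E := by
    haveI : Algebra.IsAlgebraic A K₀ := IsLocalization.isAlgebraic K₀ (nonZeroDivisors A)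
    haveI : Algebra.IsAlgebraic S A := Algebra.IsIntegral.isAlgebraic
    refine ⟨fun e => ?_⟩
    have h1 : IsAlgebraic K₀ e := Algebra.IsAlgebraic.isAlgebraic e
    have h2 : IsAlgebraic A e := IsAlgebraic.restrictScalars A h1
    exact IsAlgebraic.restrictScalars S h2
  have hSO : ∀ s : S, algebraMap S E s ∈ OE := fun s => by
    rw [hSE, ← ValuationSubring.mem_comap, hOE]
    exact hAO _
  have hdomS : ∀ s ∈ maximalIdeal S, OE.valuation (algebraMap S E s) < 1 := fun s hs => by
    rw [hSE, valuation_algebraMap_lt_one_iff_of_comap_eq' O OE hOE]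
    exact valuation_algebraMap_lt_one_of_isLocalHom O hdom s hs
  have halgS : ∀ y : OE, ∃ q : S[X], (∃ i, q.coeff i ∉ maximalIdeal S) ∧
      OE.valuation (q.eval₂ (algebraMap S E) y) < 1 :=
    forall_exists_valuation_eval₂_lt_one_of_tower O OE hOE hAO hdom halg
  -- `K₀ = Frac(S)(s₀)` for module generators `s₀` of `A` over `S`
  obtain ⟨g, hg⟩ := Module.Finite.fg_top (R := S) (M := A)
  let s₀ : Finset E := g.image fun a => algebraMap K₀ E (algebraMap A K₀ a)
  -- CLIMB
  obtain ⟨t, ht₁, ht₂, hTO, hreg⟩ := H S hexc hdimS hcharS hcomp E hinjSE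
    inferInstance halgSE OE hSO hdomS halgS s₀
  -- `t ⊆ K₀`: pull back along `φ`
  have hrange : ∀ e ∈ t, e ∈ Set.range (algebraMap K₀ E) := by
    have hcl : Subfield.closure (Set.range (algebraMap S E) ∪ (s₀ : Set E)) ≤
        (algebraMap K₀ E).fieldRange := by
      rw [Subfield.closure_le]
      rintro e (⟨s, rfl⟩ | he)
      · exact ⟨algebraMap A K₀ (s : A), (hSE s).symm⟩
      · obtain ⟨a, -, rfl⟩ := Finset.mem_image.mp (Finset.mem_coe.mp he)
        exact ⟨_, rfl⟩
    intro e he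
    exact hcl (ht₁ (Finset.mem_coe.mpr he))
  have hinjφ : Function.Injective (algebraMap K₀ E) := (algebraMap K₀ E).injective
  let t₀ : Finset K₀ := t.preimage (algebraMap K₀ E) (hinjφ.injOn)
  have ht₀ : t₀.image (algebraMap K₀ E) = t := by
    rw [Finset.image_preimage]
    exact Finset.filter_true_of_mem hrange
  have ht₀' : (algebraMap K₀ E) '' (t₀ : Set K₀) = (t : Set E) := by
    rw [← Finset.coe_image, ht₀]
  -- the model over `S` inside `K₀` and its image in `E`
  set T₀ : Subalgebra S K₀ := Algebra.adjoin S (t₀ : Set K₀) with hT₀def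
  have hmapT : T₀.map φ = Algebra.adjoin S (t : Set E) := by
    rw [hT₀def, AlgHom.map_adjoin]
    congr 1
  have hT₀O : T₀.toSubring ≤ O.toSubring := by
    intro z hz
    have h1 : φ z ∈ T₀.map φ := Subalgebra.mem_map.mpr ⟨z, hz, rfl⟩
    rw [hmapT] at h1
    have h2 : algebraMap K₀ E z ∈ OE := hTO h1
    rw [← ValuationSubring.mem_comap, hOE] at h2
    exact h2
  -- regularity of `S[t₀]` at the centre of `O`
  set P₀ : Ideal T₀ := Ideal.comap (Subring.inclusion hT₀O) (maximalIdeal O) with hP₀def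
  haveI : P₀.IsPrime := Ideal.IsPrime.comap _
  have hP₀ : ∀ x : T₀, x ∈ P₀ ↔ O.valuation (x : K₀) < 1 := fun x => by
    rw [hP₀def, Ideal.mem_comap, ValuationSubring.valuation_lt_one_iff]; rfl
  have hP₀E : ∀ x : T₀, x ∈ P₀ ↔ OE.valuation (φ x) < 1 := fun x => by
    rw [hP₀, hφ, valuation_algebraMap_lt_one_iff_of_comap_eq' O OE hOE]
  have hmapO : (T₀.map φ).toSubring ≤ OE.toSubring := by rw [hmapT]; exact hTO
  set Q : Ideal (T₀.map φ) := Ideal.comap (Subring.inclusion hmapO) (maximalIdeal OE) with hQdef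
  haveI : Q.IsPrime := Ideal.IsPrime.comap _
  have hQ : ∀ y : T₀.map φ, y ∈ Q ↔ OE.valuation (y : E) < 1 := fun y => by
    rw [hQdef, Ideal.mem_comap, ValuationSubring.valuation_lt_one_iff]; rfl
  set Pt : Ideal (Algebra.adjoin S (t : Set E)) :=
    Ideal.comap (Subring.inclusion hTO) (maximalIdeal OE) with hPtdef
  haveI : Pt.IsPrime := Ideal.IsPrime.comap _
  have hPt : ∀ y : Algebra.adjoin S (t : Set E), y ∈ Pt ↔ OE.valuation (y : E) < 1 := fun y => by
    rw [hPtdef, Ideal.mem_comap, ValuationSubring.valuation_lt_one_iff]; rfl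
  have hregQ : IsRegularLocalRing (Localization.AtPrime Q) :=
    (isRegularLocalRing_localization_iff_of_subalgebra_eq OE hmapT Q hQ Pt hPt).mpr hreg
  have hreg₀ : IsRegularLocalRing (Localization.AtPrime P₀) :=
    (isRegularLocalRing_localization_map_iff φ OE T₀ P₀ hP₀E Q hQ).mpr hregQ
  -- `Frac S[t₀] = K₀`
  have hfrac : IsFractionRing T₀ K₀ := by
    let C : Subfield K₀ := Subfield.closure (Set.range (algebraMap S K₀) ∪ (t₀ : Set K₀))
    -- `s₀ ⊆ C.map φ`
    have hCmap : Subfield.closure (Set.range (algebraMap S E) ∪ (t : Set E)) ≤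
        C.map (algebraMap K₀ E) := by
      rw [Subfield.closure_le]
      rintro e (⟨s, rfl⟩ | he)
      · refine Subfield.mem_map.mpr ⟨algebraMap S K₀ s, Subfield.subset_closure (Or.inl ⟨s, rfl⟩), ?_⟩
        rw [hSE, IsScalarTower.algebraMap_apply S A K₀]
        rfl
      · rw [← ht₀'] at he
        obtain ⟨z, hz, rfl⟩ := he
        exact Subfield.mem_map.mpr ⟨z, Subfield.subset_closure (Or.inr hz), rfl⟩
    have hgC : ∀ a ∈ g, algebraMap A K₀ a ∈ C := by
      intro a ha
      have h1 : algebraMap K₀ E (algebraMap A K₀ a) ∈ C.map (algebraMap K₀ E) := by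
        apply hCmap
        apply ht₂
        exact Finset.mem_coe.mpr (Finset.mem_image.mpr ⟨a, ha, rfl⟩)
      obtain ⟨c, hc, hce⟩ := Subfield.mem_map.mp h1
      rw [← hinjφ hce]
      exact hc
    have hAC : ∀ a : A, algebraMap A K₀ a ∈ C := by
      intro a
      have ha : a ∈ Submodule.span S (g : Set A) := by rw [hg]; exact Submodule.mem_top
      refine Submodule.span_induction (p := fun a _ => algebraMap A K₀ a ∈ C) ?_ ?_ ?_ ?_ ha
      · exact fun a ha => hgC a (Finset.mem_coe.mp ha)
      · rw [map_zero]; exact zero_mem _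
      · intro x y _ _ hx hy
        rw [map_add]; exact add_mem hx hy
      · intro c x _ hx
        rw [Algebra.smul_def, map_mul, ← IsScalarTower.algebraMap_apply]
        exact mul_mem (Subfield.subset_closure (Or.inl ⟨c, rfl⟩)) hx
    have hC : ∀ z : K₀, z ∈ C := by
      intro z
      obtain ⟨a, b, -, rfl⟩ := IsFractionRing.div_surjective (A := A) z
      exact div_mem (hAC a) (hAC b)
    have hcl : Subring.closure (Set.range (algebraMap S K₀) ∪ (t₀ : Set K₀)) ≤ T₀.toSubring := by
      rw [Subring.closure_le]
      rintro z (⟨s, rfl⟩ | hz)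
      · exact T₀.algebraMap_mem s
      · exact Algebra.subset_adjoin hz
    haveI : FaithfulSMul T₀ K₀ :=
      (faithfulSMul_iff_algebraMap_injective _ _).mpr Subtype.val_injective
    refine IsFractionRing.of_field T₀ K₀ fun z => ?_
    obtain ⟨y, hy, w, hw, hyw⟩ := Subfield.mem_closure_iff.mp (hC z)
    exact ⟨⟨y, hcl hy⟩, ⟨w, hcl hw⟩, hyw.symm⟩
  -- pass from the base `S` to the base `A`
  obtain ⟨h, hregA⟩ := exists_adjoin_isRegularLocalRing_of_isIntegral (S := S) (A := A) O t₀
    hT₀O hfrac hreg₀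
  exact ⟨t₀, h, hregA⟩

/-! ## Residue characteristic zero -/

/-- **(LU) for complete local domains of dimension three and residue characteristic `0`, from
the climb over the Cohen subring** — PROVED: `CossartPiltant2019LUCompleteChar0` follows from the
climbing statement of Cossart–Piltant's proof of Prop. 4.10 over complete excellent regular
local domains `S` of dimension three with `char (S/𝔪_S) = 0` (the case `p = 0` of
`cpLocalUniformization_of_climbAt`). In that residue characteristic the climb
`(LU v₀) ⇒ (LU v₀ⁱ) ⇒ (LU v₀ʳ) ⇒ (LU vʳ) ⇒ (LU vⁱ) ⇒ (LU v)` has no purely inseparable preamble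
(`char K = 0`) and an empty step `(LU v₀ʳ) ⇒ (LU vʳ)`
(`fixedField_ramificationGroupIn_eq_top_of_charZero`), so it never meets Thm. 1.5.
[cite: CossartPiltant2019, proof of Prop. 4.10 (arXiv v1: Prop. 4.8, pp. 53–54)] -/
theorem CossartPiltant2019LUCompleteChar0.of_climb
    (H : ∀ (S : Type u) [CommRing S] [IsDomain S] [IsRegularLocalRing S],
        IsExcellentRing S → ringKrullDim S = 3 → CharZero (ResidueField S) →
        IsAdicComplete (maximalIdeal S) S →
      ∀ (E : Type u) [Field E] [Algebra S E], Function.Injective (algebraMap S E) →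
        IsAlgClosed E → Algebra.IsAlgebraic S E →
      ∀ (OE : ValuationSubring E), (∀ s : S, algebraMap S E s ∈ OE) →
        (∀ s ∈ maximalIdeal S, OE.valuation (algebraMap S E s) < 1) →
        (∀ y : OE, ∃ q : S[X], (∃ i, q.coeff i ∉ maximalIdeal S) ∧
          OE.valuation (q.eval₂ (algebraMap S E) y) < 1) →
      ∀ (s₀ : Finset E),
        ∃ t : Finset E,
          (t : Set E) ⊆ Subfield.closure (Set.range (algebraMap S E) ∪ (s₀ : Set E)) ∧
          (s₀ : Set E) ⊆ Subfield.closure (Set.range (algebraMap S E) ∪ (t : Set E)) ∧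
          ∃ hTO : (Algebra.adjoin S (t : Set E)).toSubring ≤ OE.toSubring,
            IsRegularLocalRing (Localization.AtPrime
              (Ideal.comap (Subring.inclusion hTO) (maximalIdeal OE)))) :
    CossartPiltant2019LUCompleteChar0.{u} := by
  intro A _ _ _ _ _ hdim hchar0
  haveI := hchar0
  refine cpLocalUniformization_of_climbAt 0 ?_ A hdim (CharP.ofCharZero _)
  intro S _ _ _ hexc hdimS hcharS hcomp
  haveI := hcharS
  exact H S hexc hdimS (CharP.charP_to_charZero (ResidueField S)) hcomp

end Literature.AlgebraicGeometry.Resolution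

end
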